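import Mathlib
import Summits.Ventures.HodgeRepro2.T5Assembly
import Summits.Ventures.HodgeRepro2.T6N5Signs

/-!
# T6N5Skeleton — the logical skeleton of TIER5 §N5 (toric period (R4)) as named Props over abstract
side data, carrier-free

Tier 6 (README §10), sub-step N5 of the M2 discharge (TARGET-T6 §3 row N5, §4 L4; owners t6-p7 /
t6-p8).  The record formalised is the REDUCTION CHAIN of route/T5-route-2.md v0.21 §N5.1 (TIER5.md
ll. 1776–1788):

    N5 ⟸ [N5.L1, A]  P_{T_A,χ_A} ≢ 0 on π₀  and  P_{T_B,χ_B} ≢ 0 on π₀′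
       ⟺ [N5.T1 = Borade et al. Thm 5.4 ×2, P]  (a_A) ∧ (b_A) ∧ (c_A) ∧ (a_B) ∧ (b_B) ∧ (c_B),

where for a side X with lines (a, b):  (a_X) β′ = (ξ′_A⁻²·ξ_A)∘j⁻¹ · (χ_aχ_b)|_{E¹_Δ(𝔸)};
(b_X) for every place v and each line i ∈ {a, b}: ω_{E_v/F_v}(λ_i) = ε_{E_v/F_v}(ξ_i, ψ_v, δ);
(c_X) L(½, ξ_a)·L(½, ξ_b) ≠ 0;  and N5 := (ii_A) ∧ (ii_B) with (ii_X) «there is an open compact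
K₀ ⊂ U(W_X)(𝔸_f) such that P_{T_X,χ_X} is not identically zero on π₀^{K₀,τ′}».

This file fixes the SHAPE over which the M2 displays of N5 are stated (Theorem 5.4 as the Prop
`ToricSide.dichotomy`, consumed by name; N5.L1 as `ToricSide.levelReduction`, discharged at M2 from
`T5LevelReduction`), and proves the assembly N5 ⟸ (T1 ×2) ∧ (L1 ×2) ∧ (a, b, c) ×2 together with the
[P†] consequences of §N5.5 in their skeleton form (S-H necessity, the opposite-sign rule at S_g, the
R-sign).  Signs are `ℤˣ`; characters of the compact group [E¹] are an arbitrary commutative group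
`G`; places are an arbitrary index type `ι`; the conclusion N5 plugs into p7's Tier-5 assembly
skeleton `T5Assembly.AssemblyCore` through its fields `iiA` / `iiB` (`N5Data.assembly_ii`).

No displayed hypothesis lives here (no `[cite:` docstring; the display file is the N5 hypothesis
file of the M2 owner); nothing automorphic is constructed.  §8(d): uses an L-value-free
non-vanishing device: NO.
-/

namespace Summit.Ventures.HodgeRepro2.T6.N5Skeleton

open scoped BigOperators

/-- The data of ONE side X ∈ {A, B} of N5 = one application of Theorem 5.4 (TIER5 §N5.3 / §N5.4):
the torus T_X = U(W_a) × U(W_b) with its two lines, the occurring torus character χ_X = χ_a ⊠ χ_b,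
the lift π₀ (resp. π₀′) of β′, and the signs / central values that conditions (a), (b), (c) compare.
`ι` indexes the places of F, `G` is the group of (Hecke) characters of [E¹]. -/
structure ToricSide (ι G : Type*) [CommGroup G] where
  /-- «P_{T_X,χ_X} is not identically zero on π₀» — the left side of Theorem 5.4's conclusion. -/
  periodNonzero : Prop
  /-- (ii_X): «there is an open compact K₀ with P_{T_X,χ_X} ≢ 0 on π₀^{K₀,τ′}» (TIER5 §N5.1). -/
  levelPeriodNonzero : Prop
  /-- β′, the character of [U(V′)] = [E¹] lifted (Theorem 5.4's β). -/
  β : G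
  /-- the factor (ξ′_A⁻²·ξ_A)∘j_{𝔸_F}⁻¹ of condition (a) (Theorem 5.4's (χ_W⁻ⁿ·χ_V)∘j⁻¹, n = 2). -/
  f : G
  /-- the restriction (χ_aχ_b)|_{E¹_Δ(𝔸)} of the torus character to the diagonal (Theorem 5.4's α|). -/
  r : G
  /-- ω_{E_v/F_v}(λ_i): the local quadratic symbol of the line datum λ_i = w⁻¹e_i, place v, line i. -/
  omega : ι → Fin 2 → ℤˣ
  /-- ε_{E_v/F_v}(ξ_i, ψ_v, δ): the local root number of the line character ξ_i at v
  (the entry of Borade's tuple ε_{K_E⊗F_v/K⊗F_v}; := 1 at a split place). -/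
  eps : ι → Fin 2 → ℤˣ
  /-- L(½, ξ_i): the central value of the line character (Borade's L*(·) = the product over the
  two field factors of K = F × F). -/
  Lval : Fin 2 → ℂ

namespace ToricSide

variable {ι G : Type*} [CommGroup G] (X : ToricSide ι G)

/-- Condition (a_X) of Theorem 5.4 for this side: β′ = (ξ′_A⁻²·ξ_A)∘j⁻¹ · (χ_aχ_b)|_Δ. -/
def condA : Prop := X.β = X.f * X.r

/-- Condition (b_X): for every place v and each line i, ω_{E_v/F_v}(λ_i) = ε_{E_v/F_v}(ξ_i, ψ_v, δ)
(TIER5 Δ-N5-1: TWO sign equations per place, one per line). -/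
def condB : Prop := ∀ v : ι, ∀ i : Fin 2, X.omega v i = X.eps v i

/-- Condition (c_X): L(½, ξ_a)·L(½, ξ_b) ≠ 0. -/
def condC : Prop := X.Lval 0 * X.Lval 1 ≠ 0

/-- The conclusion SHAPE of Theorem 5.4 for this side (TIER5 N5.T1 / N5.L2): «P_{T_X,χ_X} is not
identically zero on π₀ if and only if the three conditions (a), (b), (c) are satisfied».  The M2
display `Hyp.BFGYYZ2025_Thm5_4` asserts this Prop for every side built from Theorem 5.4's data. -/
def dichotomy : Prop := X.periodNonzero ↔ (X.condA ∧ X.condB ∧ X.condC)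

/-- Lemma N5.L1 (level and K_∞-type) for this side: «if P ≢ 0 on π₀ then there is an open compact
K₀ with P ≢ 0 on π₀^{K₀,τ′}» — discharged at M2 from `T5LevelReduction` on the actual
representation. -/
def levelReduction : Prop := X.periodNonzero → X.levelPeriodNonzero

variable {X}

/-- Theorem 5.4, the «if» direction: the three conditions give the non-vanishing of the period. -/
theorem periodNonzero_of (hT : X.dichotomy) (ha : X.condA) (hb : X.condB) (hc : X.condC) :
    X.periodNonzero :=
  hT.mpr ⟨ha, hb, hc⟩

/-- Theorem 5.4, the «only if» direction, first condition. -/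
theorem condA_of_periodNonzero (hT : X.dichotomy) (hP : X.periodNonzero) : X.condA :=
  (hT.mp hP).1

/-- Theorem 5.4, the «only if» direction, second condition. -/
theorem condB_of_periodNonzero (hT : X.dichotomy) (hP : X.periodNonzero) : X.condB :=
  (hT.mp hP).2.1

/-- Theorem 5.4, the «only if» direction, third condition. -/
theorem condC_of_periodNonzero (hT : X.dichotomy) (hP : X.periodNonzero) : X.condC :=
  (hT.mp hP).2.2

/-- (ii_X) from Theorem 5.4 + Lemma N5.L1 + the three conditions. -/
theorem levelPeriodNonzero_of (hT : X.dichotomy) (hL : X.levelReduction)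
    (ha : X.condA) (hb : X.condB) (hc : X.condC) : X.levelPeriodNonzero :=
  hL (periodNonzero_of hT ha hb hc)

/-- (c_X) from the two central values separately. -/
theorem condC_of_ne_zero (h : ∀ i : Fin 2, X.Lval i ≠ 0) : X.condC :=
  mul_ne_zero (h 0) (h 1)

/-- TIER5 §N5.5(c) (R-sign) on this side, line i: under (b_X), the product formula
∏_v ω_v(λ_i) = 1 (Hilbert reciprocity) and Tate's ∏_v ε_v(ξ_i) = ε(½, ξ_i) give ε(½, ξ_i) = +1. -/
theorem rsign (hb : X.condB) (i : Fin 2) (εglob : ℤˣ)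
    (hω : ∏ᶠ v, X.omega v i = 1) (hε : ∏ᶠ v, X.eps v i = εglob) : εglob = 1 :=
  N5Signs.rsign_of_condB (fun v => X.omega v i) (fun v => X.eps v i) εglob (fun v => hb v i) hω hε

end ToricSide

/-- The two sides of N5 with the two compatibilities the record imposes on them (TIER5 §N5.4 row H5
column B «the SAME β′ must satisfy (a_A) and (a_B)» and row H6 column B «π₀′ with the same
(ξ_A, ξ′_A)» = (H_χ), interface I3). -/
structure N5Data (ι G : Type*) [CommGroup G] where
  /-- side A: lines (111, 100), torus T_A, lift π₀ = Θ_{V′→W_A}(β′). -/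
  A : ToricSide ι G
  /-- side B: lines (101, 110), torus T_B, lift π₀′ = Θ_{V′→W_B}(β′). -/
  B : ToricSide ι G
  /-- the same β′ on both sides. -/
  same_β : A.β = B.β
  /-- the same splitting characters (ξ_A, ξ′_A) on both sides — (H_χ), N2 (A5). -/
  same_f : A.f = B.f

namespace N5Data

variable {ι G : Type*} [CommGroup G] (D : N5Data ι G)

/-- N5 := (ii_A) ∧ (ii_B) (TIER5 §N5.1). -/
def N5 : Prop := D.A.levelPeriodNonzero ∧ D.B.levelPeriodNonzero

/-- The (c)-residual of N5 as ONE statement: both products of central values are non-zero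
([G-N5.1] of TIER5 §N5.8; route-3 §G's cofinite form at M2). -/
def condC : Prop := D.A.condC ∧ D.B.condC

variable {D}

/-- THE ASSEMBLY OF N5 (TIER5 §N5.1 reduction chain): Theorem 5.4 on both sides (`dichotomy`),
Lemma N5.L1 on both sides (`levelReduction`), and the six conditions give N5. -/
theorem N5_of (hTA : D.A.dichotomy) (hTB : D.B.dichotomy)
    (hLA : D.A.levelReduction) (hLB : D.B.levelReduction)
    (haA : D.A.condA) (haB : D.B.condA) (hbA : D.A.condB) (hbB : D.B.condB)
    (hcA : D.A.condC) (hcB : D.B.condC) : D.N5 :=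
  ⟨ToricSide.levelPeriodNonzero_of hTA hLA haA hbA hcA,
    ToricSide.levelPeriodNonzero_of hTB hLB haB hbB hcB⟩

/-- The same assembly with the (c)-residual as a single explicit binder `hc : D.condC`
(the form in which [G-N5.1] enters an M2 statement that does not discharge it). -/
theorem N5_of_residual (hTA : D.A.dichotomy) (hTB : D.B.dichotomy)
    (hLA : D.A.levelReduction) (hLB : D.B.levelReduction)
    (haA : D.A.condA) (haB : D.B.condA) (hbA : D.A.condB) (hbB : D.B.condB)
    (hc : D.condC) : D.N5 :=
  N5_of hTA hTB hLA hLB haA haB hbA hbB hc.1 hc.2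

/-- TIER5 §N5.5(b) (S-H is NECESSARY): (a_A) ∧ (a_B) with the same β′ and the same factor force
(χ_{111}χ_{100})|_Δ = (χ_{101}χ_{110})|_Δ. -/
theorem restriction_eq (haA : D.A.condA) (haB : D.B.condA) : D.A.r = D.B.r :=
  N5Signs.restriction_eq_of_condA (G := G) (β := D.A.β) (f := D.A.f) haA
    (by rw [D.same_β, D.same_f]; exact haB)

/-- TIER5 §N5.5(b) read through Theorem 5.4: if both periods are non-zero, S-H holds. -/
theorem restriction_eq_of_periodNonzero (hTA : D.A.dichotomy) (hTB : D.B.dichotomy)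
    (hPA : D.A.periodNonzero) (hPB : D.B.periodNonzero) : D.A.r = D.B.r :=
  restriction_eq (ToricSide.condA_of_periodNonzero hTA hPA)
    (ToricSide.condA_of_periodNonzero hTB hPB)

/-- TIER5 §N5.5(e): at a place v where the datum signs of a line are opposite on the two sides
(v ∈ S_g: ω_v(λ_c) = ω_v(u)·ω_v(λ_a) = −ω_v(λ_a)), (b_A) ∧ (b_B) force opposite local root
numbers ε_v(ξ_{101}) = −ε_v(ξ_{111}) (and likewise on the other line). -/
theorem eps_neg_at (v : ι) (i : Fin 2) (hu : D.B.omega v i = -D.A.omega v i)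
    (hbA : D.A.condB) (hbB : D.B.condB) : D.B.eps v i = -D.A.eps v i :=
  N5Signs.eps_neg_of_condB_both (fun u : ℤˣ => u) hu (hbA v i) (hbB v i)

/-- The seam with p7's Tier-5 assembly skeleton: if the assembly's fields (ii_A), (ii_B) ARE the two
sides' level statements, N5 delivers `iiA ∧ iiB` (the hypothesis of `T5Assembly.ND_of_N4_N5`). -/
theorem assembly_ii {S Datum Choice K : Type*} [Zero K]
    (A : T5Assembly.AssemblyCore S Datum Choice K)
    (hA : A.iiA = D.A.levelPeriodNonzero) (hB : A.iiB = D.B.levelPeriodNonzero)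
    (h : D.N5) : A.iiA ∧ A.iiB := by
  rw [hA, hB]; exact h

end N5Data

end Summit.Ventures.HodgeRepro2.T6.N5Skeleton
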